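import Literature.Geometry.Lorentzian.KerrDeSitterSurfaceGravities
import HarnessLib

/-!
# Subextremal Kerr–de Sitter parameters satisfy the PRINTED discriminant conditions:
# Hintz–Petersen–Vasy (1.2) `D_HPV > 0` and Casals–Teixeira da Costa (3.1) `D_CTdC < 0` (theorems only)

Theorems only (no named facts, no new definitions). The tree's standing hypothesis on `(M, a, Λ)` is
`IsSubextremal M a Λ` (`KerrDeSitter.lean`: `M, Λ > 0` and the root/sign pattern of `Δ_r` at
`r₋ < r₊ < r_c`), whereas the cited sources print their hypothesis as a DISCRIMINANT inequality:
Casals–Teixeira da Costa [CasalsTeixeiradacosta2022, (3.1)] "`27M⁴ + L⁴(Ξ−1)Ξ⁴ + L²M²(Ξ−2)(−32+Ξ(32+Ξ)) < 0`"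
(`= subextremalDiscriminantCTdC M a Λ < 0`, `KerrDeSitterTeukolskyRadial.lean`) and Hintz–Petersen–Vasy
[HintzPetersenVasy2025, (1.2)] "`−(1+Λa²/3)⁴(a/m)² + 12(1−Λa²/3)Λa² + (1−Λa²/3)³ − 9Λm² > 0`"
(`= 0 < subextremalDiscriminantHPV M a Λ`), the latter printed as EQUIVALENT to "`μ` has four distinct
real roots". This file proves the direction the citations need — OUR hypothesis implies THEIRS, verbatim:

* `quarticDisc_eq_prod_sq` — for a depressed quartic with leading coefficient `A` and roots
  `x, y, z, w = −(x+y+z)`, the discriminant polynomial in the coefficients equals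
  `A⁶ ∏_{i<j} (rᵢ − rⱼ)²` (`ring`);
* `subextremalDiscriminantHPV_mul_eq` — `D_HPV · (16ΛM²/3) = disc(Δ_r)
  = (Λ/3)⁶ (r₊−r₋)²(r_c−r₋)²(r_c−r₊)²(2r₋+r₊+r_c)²(r₋+2r₊+r_c)²(r₋+r₊+2r_c)²` on every subextremal
  `(M, a, Λ)` (the fourth root of `Δ_r` is `−(r₋+r₊+r_c)`, `delta_eq_prod`; Vieta from
  `KerrDeSitterSurfaceGravities.lean`);
* `subextremalDiscriminantHPV_pos` — `IsSubextremal M a Λ → 0 < subextremalDiscriminantHPV M a Λ`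
  [HintzPetersenVasy2025, (1.2), direction "four distinct real roots ⇒ `D > 0`"];
* `subextremalDiscriminantCTdC_neg` — `IsSubextremal M a Λ → subextremalDiscriminantCTdC M a Λ < 0`
  [CasalsTeixeiradacosta2022, (3.1)], via the landed proportionality `subextremalDiscriminantCTdC_eq`
  (`D_CTdC = −(3M²/Λ)·D_HPV`).

So every theorem of the venture stated under `IsSubextremal` sits inside the printed parameter ranges of
both sources (closes the "→" half of lit/H1H3-AS-PRINTED.md §1 row 1; the converse is not attempted here).

## References
* M. Casals, R. Teixeira da Costa, Commun. Math. Phys. 394 (2022), arXiv:2105.13329 v3, (3.1)–(3.2).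
  [CasalsTeixeiradacosta2022]
* P. Hintz, O. Petersen, A. Vasy, *Non-linear stability of Kerr–de Sitter black holes in the full subextremal range*, arXiv:2508.06620, (1.2).
  [HintzPetersenVasy2025]
-/

noncomputable section

namespace Literature.Geometry.Lorentzian.KerrDeSitter

section Discriminant

variable {M a Λ : ℝ}

/-- The discriminant of a DEPRESSED real quartic `A r⁴ + C r² + D r + E` with roots `x, y, z` and
`w = −(x+y+z)` (so `C = A·e₂`, `D = −A·e₃`, `E = A·e₄` of the four roots), written as the classical
polynomial in the coefficients (`B = 0`): `256A³E³ − 128A²C²E² + 144A²CD²E − 27A²D⁴ + 16AC⁴E − 4AC³D²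
= A⁶ ∏_{i<j}(rᵢ − rⱼ)²`. A polynomial identity (`ring`). [cite: HintzPetersenVasy2025, (1.2)] -/
theorem quarticDisc_eq_prod_sq (A x y z : ℝ) :
    let w := -(x + y + z)
    let C := A * (x * y + x * z + x * w + y * z + y * w + z * w)
    let D := -A * (x * y * z + x * y * w + x * z * w + y * z * w)
    let E := A * (x * y * z * w)
    256 * A ^ 3 * E ^ 3 - 128 * A ^ 2 * C ^ 2 * E ^ 2 + 144 * A ^ 2 * C * D ^ 2 * E -
        27 * A ^ 2 * D ^ 4 + 16 * A * C ^ 4 * E - 4 * A * C ^ 3 * D ^ 2 =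
      A ^ 6 * ((x - y) ^ 2 * (x - z) ^ 2 * (y - z) ^ 2 * (x - w) ^ 2 * (y - w) ^ 2 * (z - w) ^ 2) := by
  intro w C D E
  simp only [w, C, D, E]
  ring

/-- **`disc(Δ_r) = (16ΛM²/3)·D_HPV = (Λ/3)⁶ ∏_{i<j}(rᵢ − rⱼ)²`** on every subextremal Kerr–de Sitter:
the printed Hintz–Petersen–Vasy discriminant times the positive factor `16ΛM²/3` is the discriminant of
`Δ_r = −(Λ/3)r⁴ + (1 − Λa²/3)r² − 2Mr + a²`, whose roots are `r₋, r₊, r_c` and `−(r₋+r₊+r_c)`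
(`delta_eq_prod`), so that the six root differences are `r₊−r₋, r_c−r₋, r_c−r₊, 2r₋+r₊+r_c, r₋+2r₊+r_c,
r₋+r₊+2r_c`. [cite: HintzPetersenVasy2025, (1.2)] -/
theorem subextremalDiscriminantHPV_mul_eq (hsub : IsSubextremal M a Λ) :
    subextremalDiscriminantHPV M a Λ * (16 * Λ * M ^ 2 / 3) =
      (Λ / 3) ^ 6 * ((rPlus M a Λ - rMinus M a Λ) ^ 2 * (rCosmo M a Λ - rMinus M a Λ) ^ 2 *
        (rCosmo M a Λ - rPlus M a Λ) ^ 2 * (2 * rMinus M a Λ + rPlus M a Λ + rCosmo M a Λ) ^ 2 *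
        (rMinus M a Λ + 2 * rPlus M a Λ + rCosmo M a Λ) ^ 2 *
        (rMinus M a Λ + rPlus M a Λ + 2 * rCosmo M a Λ) ^ 2) := by
  have hM0 : M ≠ 0 := hsub.1.ne'
  -- Step 1 (identity in `M, a, Λ` alone): `D_HPV · 16ΛM²/3` is the classical discriminant polynomial of
  -- the depressed quartic with `A = −Λ/3`, `C = 1 − (Λ/3)a²`, `D = −2M`, `E = a²`.
  have step1 : subextremalDiscriminantHPV M a Λ * (16 * Λ * M ^ 2 / 3) =
      256 * (-(Λ / 3)) ^ 3 * (a ^ 2) ^ 3 - 128 * (-(Λ / 3)) ^ 2 * (1 - Λ / 3 * a ^ 2) ^ 2 * (a ^ 2) ^ 2 +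
        144 * (-(Λ / 3)) ^ 2 * (1 - Λ / 3 * a ^ 2) * (-2 * M) ^ 2 * a ^ 2 -
        27 * (-(Λ / 3)) ^ 2 * (-2 * M) ^ 4 + 16 * (-(Λ / 3)) * (1 - Λ / 3 * a ^ 2) ^ 4 * a ^ 2 -
        4 * (-(Λ / 3)) * (1 - Λ / 3 * a ^ 2) ^ 3 * (-2 * M) ^ 2 := by
    unfold subextremalDiscriminantHPV
    field_simp
    ring
  -- Step 2: the coefficients in root form (Vieta), then the generic identity.
  have hD : -2 * M = -(Λ / 3 * ((rMinus M a Λ * rPlus M a Λ + rPlus M a Λ * rCosmo M a Λ +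
      rCosmo M a Λ * rMinus M a Λ) * (rMinus M a Λ + rPlus M a Λ + rCosmo M a Λ) -
        rMinus M a Λ * rPlus M a Λ * rCosmo M a Λ)) := by
    linear_combination -(vieta_M hsub)
  rw [step1, vieta_sq hsub, hD, vieta_aSq hsub]
  have key := quarticDisc_eq_prod_sq (-(Λ / 3)) (rMinus M a Λ) (rPlus M a Λ) (rCosmo M a Λ)
  simp only at key
  linear_combination key

/-- **Subextremal ⇒ Hintz–Petersen–Vasy's printed condition `D > 0`** (their (1.2), direction
"`μ` has four distinct real roots ⇒ discriminant positive"): on every subextremal `(M, a, Λ)` the six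
root differences of `Δ_r` are nonzero, so `disc(Δ_r) > 0`, and `16ΛM²/3 > 0`.
[cite: HintzPetersenVasy2025, (1.2)] -/
theorem subextremalDiscriminantHPV_pos (hsub : IsSubextremal M a Λ) :
    0 < subextremalDiscriminantHPV M a Λ := by
  have h := subextremalDiscriminantHPV_mul_eq hsub
  have h0 := rMinus_nonneg M a Λ
  obtain ⟨hM, hΛ, h01, h12, -⟩ := hsub
  have h16 : 0 < 16 * Λ * M ^ 2 / 3 := by positivity
  have hprod : 0 < (Λ / 3) ^ 6 * ((rPlus M a Λ - rMinus M a Λ) ^ 2 * (rCosmo M a Λ - rMinus M a Λ) ^ 2 *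
      (rCosmo M a Λ - rPlus M a Λ) ^ 2 * (2 * rMinus M a Λ + rPlus M a Λ + rCosmo M a Λ) ^ 2 *
      (rMinus M a Λ + 2 * rPlus M a Λ + rCosmo M a Λ) ^ 2 *
      (rMinus M a Λ + rPlus M a Λ + 2 * rCosmo M a Λ) ^ 2) := by
    have d1 : 0 < rPlus M a Λ - rMinus M a Λ := sub_pos.2 h01
    have d2 : 0 < rCosmo M a Λ - rMinus M a Λ := sub_pos.2 (h01.trans h12)
    have d3 : 0 < rCosmo M a Λ - rPlus M a Λ := sub_pos.2 h12
    have d4 : 0 < 2 * rMinus M a Λ + rPlus M a Λ + rCosmo M a Λ := by linarith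
    have d5 : 0 < rMinus M a Λ + 2 * rPlus M a Λ + rCosmo M a Λ := by linarith
    have d6 : 0 < rMinus M a Λ + rPlus M a Λ + 2 * rCosmo M a Λ := by linarith
    positivity
  rw [← h] at hprod
  exact (mul_pos_iff_of_pos_right h16).1 hprod

/-- **Subextremal ⇒ Casals–Teixeira da Costa's printed condition (3.1)** `D_CTdC < 0`: by the landed
proportionality `D_CTdC = −(3M²/Λ)·D_HPV` (`subextremalDiscriminantCTdC_eq`) and
`subextremalDiscriminantHPV_pos`. So the parameter hypothesis of every theorem the venture states under
`IsSubextremal` lies inside the printed range "(3.1)" of [CasalsTeixeiradacosta2022, Theorem 3.10].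
[cite: CasalsTeixeiradacosta2022, (3.1)] -/
theorem subextremalDiscriminantCTdC_neg (hsub : IsSubextremal M a Λ) :
    subextremalDiscriminantCTdC M a Λ < 0 := by
  have hpos := subextremalDiscriminantHPV_pos hsub
  obtain ⟨hM, hΛ, -⟩ := hsub
  rw [subextremalDiscriminantCTdC_eq M a Λ hM.ne' hΛ.ne']
  have hneg : -(3 * M ^ 2 / Λ) < 0 := by
    have : 0 < 3 * M ^ 2 / Λ := by positivity
    linarith
  exact mul_neg_of_neg_of_pos hneg hpos

end Discriminant

end Literature.Geometry.Lorentzian.KerrDeSitter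

end
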